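import Summits.CriticalPhenomena.PercolationContinuityZ3.Theses.PercCriticalCaps
import Summits.CriticalPhenomena.PercolationContinuityZ3.Theorems.PercNearOneGluingNoHeavyLowerTailCSHTheoremOne
import Literature.Probability.Percolation.RSW
import Literature.Probability.Percolation.ZeroOneLaw
import Literature.Probability.Percolation.TwoPointFunction
import Literature.Probability.Percolation.BondPercolationSymmetry
import Literature.Probability.Percolation.PercolationProofs
import Literature.Probability.LatticeModels.LatticeGraph
import Mathlib.Dynamics.Ergodic.Ergodic
import HarnessLib

/-!
# `PercCriticalCaps.CapZeroOne` (stmt-CriticalPhenomena-7516) — SETTLED after continuity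

Item `stmt-CriticalPhenomena-7516` of route `CriticalPhenomena/PercCriticalCaps` (support (calibration)): `P_p(finitely many t > 0 with t·e₀ ↔ {y₀ = 0}) ∈ {0, 1}` for every `d ≥ 1` and `p`.

The shift by `−e₀` (`T = relabel (shift (−e₀))`, ergodic: `ergodic_relabel_shift_bondPercolation`) maps a hit at height `t ≥ 2` to a hit at height `t − 1` (an open lattice path from height `t` to height 0 visits height 1: `Walk.exists_boundary_dart`; `preimage_relabel_shift_openConn`), so `T⁻¹'F ⊆ F` a.s. for the finite-hits event `F` (measurable: finitely many hits iff bounded above); Mathlib `Ergodic.ae_empty_or_univ_of_preimage_ae_le`.  p205010 is NOT used.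

builds on p205010 (kernel theorem, internal audit signed; external expert review pending) — USED (`CSH.percolationContinuityZ3_holds`).  RSW3 lane, lead gen 28 (prover-prim-rsw3-lead-g28-0):
'after continuity — the ledger harvest'.
References: G. Kozma, N. Nitzan (2024), Thm. 6 / Conj. 3 [KozmaNitzan2024]; G. Grimmett, *Percolation* (1999), §8 [GrimmettPercolation1999].
-/

noncomputable section

namespace Summit.CriticalPhenomena.PercolationContinuityZ3.Theorems

namespace PercCriticalCapsCapZeroOne

open MeasureTheory Literature.Probability.Percolation Literature.Probability.LatticeModels

variable {d : ℕ}

/-- Neighbours in `ℤ^d` differ by at most one in the first coordinate. [folklore] -/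
theorem sub_one_le_apply_zero_of_adj [NeZero d] {x y : Site d} (h : (zdGraph d).Adj x y) : x 0 - 1 ≤ y 0 := by
  obtain ⟨i, h | h⟩ := (zdGraph_adj_iff x y).1 h
  · rw [h, Pi.add_apply]
    by_cases hi : (0 : Fin d) = i
    · subst hi; rw [Pi.single_eq_same]; omega
    · rw [Pi.single_eq_of_ne hi]; omega
  · rw [h, Pi.add_apply]
    by_cases hi : (0 : Fin d) = i
    · subst hi; rw [Pi.single_eq_same]; omega
    · rw [Pi.single_eq_of_ne hi]; omega

/-- Discrete intermediate value: an open lattice path from height `≥ 2` to height `0` visits height `1`. [folklore] -/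
theorem exists_openConn_apply_zero_eq_one [NeZero d] {ω : BondConfig (Site d)} (hω : ω ⊆ (zdGraph d).edgeSet)
    {x y : Site d} (hx : 2 ≤ x 0) (hy : y 0 = 0) (h : ω ∈ openConn x y) :
    ∃ w : Site d, w 0 = 1 ∧ ω ∈ openConn x w := by
  obtain ⟨p⟩ := h
  obtain ⟨e, he, h1, h2⟩ := p.exists_boundary_dart {z : Site d | 2 ≤ z 0} hx (by simp [hy])
  simp only [Set.mem_setOf_eq, not_le] at h1 h2
  have hadj : (zdGraph d).Adj e.fst e.snd := by
    have := (openGraph_adj ω _ _).1 e.adj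
    exact (SimpleGraph.mem_edgeSet (zdGraph d)).1 (hω this.1)
  have h3 := sub_one_le_apply_zero_of_adj hadj
  refine ⟨e.snd, by omega, ⟨p.takeUntil e.snd (p.dart_snd_mem_support_of_mem_darts he)⟩⟩

/-- **`PercCriticalCaps.CapZeroOne` (stmt-CriticalPhenomena-7516), settled.**  ergodic shift + discrete intermediate value; `Ergodic.ae_empty_or_univ_of_preimage_ae_le`.
[cite: KozmaNitzan2024, Thm. 6 with Conj. 3 (p. 15)] -/
theorem capZeroOne_proof : Summit.CriticalPhenomena.PercolationContinuityZ3.Theses.PercCriticalCaps.CapZeroOne := by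
  intro d _ p
  classical
  set μ := bondPercolation (zdGraph d) p with hμ
  -- the hit predicate and the finite-hits event
  set H : BondConfig (Site d) → ℤ → Prop := fun ω t =>
    0 < t ∧ ∃ y : Site d, y 0 = 0 ∧ ω ∈ openConn (Pi.single 0 t : Site d) y with hH
  set F : Set (BondConfig (Site d)) := {ω | Set.Finite {t : ℤ | H ω t}} with hF
  change μ F = 0 ∨ μ F = 1
  -- measurability: finitely many hits iff the hits are bounded above
  have hHm : ∀ t : ℤ, MeasurableSet {ω : BondConfig (Site d) | H ω t} := by
    intro t
    have : {ω : BondConfig (Site d) | H ω t} = ⋃ y : {y : Site d // y 0 = 0}, {ω | 0 < t} ∩ openConn (Pi.single 0 t : Site d) (y : Site d) := by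
      ext ω
      simp only [hH, Set.mem_setOf_eq, Set.mem_iUnion, Set.mem_inter_iff, Subtype.exists, exists_prop]
      constructor
      · rintro ⟨ht, y, hy, hω⟩; exact ⟨y, hy, ht, hω⟩
      · rintro ⟨y, hy, ht, hω⟩; exact ⟨ht, y, hy, hω⟩
    rw [this]
    exact MeasurableSet.iUnion fun y => (MeasurableSet.const _).inter (measurableSet_openConn_holds _ _)
  have hFeq : F = ⋃ N : ℕ, ⋂ t : ℤ, {ω | H ω t → t ≤ N} := by
    ext ω
    simp only [hF, Set.mem_setOf_eq, Set.mem_iUnion, Set.mem_iInter]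
    constructor
    · intro hfin
      obtain ⟨M, hM⟩ := hfin.bddAbove
      exact ⟨M.toNat, fun t ht => (hM ht).trans (Int.self_le_toNat M)⟩
    · rintro ⟨N, hN⟩
      exact (Set.finite_Icc (1 : ℤ) N).subset fun t ht => ⟨by have := ht.1; omega, hN t ht⟩
  have hFm : MeasurableSet F := by
    rw [hFeq]
    refine MeasurableSet.iUnion fun N => MeasurableSet.iInter fun t => ?_
    have : {ω : BondConfig (Site d) | H ω t → t ≤ (N : ℤ)} = {ω | H ω t}ᶜ ∪ {ω | t ≤ (N : ℤ)} := by
      ext ω; simp only [Set.mem_setOf_eq, Set.mem_union, Set.mem_compl_iff, imp_iff_not_or]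
    rw [this]
    exact (hHm t).compl.union (MeasurableSet.const _)
  -- the shift by `-e₀` is ergodic and maps a hit at height `t ≥ 2` to a hit at height `t - 1`
  set v : Site d := -Pi.single 0 1 with hv
  have hv0 : v ≠ 0 := by
    intro h
    have := congr_fun h 0
    simp [hv] at this
  have herg := ergodic_relabel_shift_bondPercolation p hv0
  set T := BondConfig.relabel (sym2Equiv (Site.shift v)) with hT
  have hle : (T ⁻¹' F : Set (BondConfig (Site d))) ≤ᵐ[μ] F := by
    filter_upwards [ae_subset_edgeSet (zdGraph d) p] with ω hω hTF
    have hTF' : Set.Finite {t : ℤ | H (T ω) t} := hTF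
    have hsub : {t : ℤ | H ω t} ⊆ insert 1 ((fun s : ℤ => s + 1) '' {t : ℤ | H (T ω) t}) := by
      rintro t ⟨ht, y, hy, hω'⟩
      rcases eq_or_lt_of_le (show (1 : ℤ) ≤ t from ht) with h1 | h1
      · exact Or.inl h1.symm
      · refine Or.inr ⟨t - 1, ⟨by omega, ?_⟩, by ring⟩
        have hx : (2 : ℤ) ≤ (Pi.single 0 t : Site d) 0 := by simp; omega
        obtain ⟨w, hw, hωw⟩ := exists_openConn_apply_zero_eq_one hω hx hy hω'
        refine ⟨w + v, by simp [hv, hw], ?_⟩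
        have h := preimage_relabel_shift_openConn v (Pi.single 0 t : Site d) w
        have hmem : ω ∈ T ⁻¹' (openConn ((Pi.single 0 t : Site d) + v) (w + v) : Set (BondConfig (Site d))) := by
          rw [hT, h]; exact hωw
        have hs : (Pi.single 0 t : Site d) + v = Pi.single 0 (t - 1) := by
          rw [hv, Pi.single_sub, sub_eq_add_neg]
        rw [hs] at hmem
        exact hmem
    exact ((hTF'.image _).insert 1).subset hsub
  rcases herg.ae_empty_or_univ_of_preimage_ae_le hFm.nullMeasurableSet hle with h | h
  · left; rw [measure_congr h, measure_empty]
  · right; rw [measure_congr h, measure_univ]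

end PercCriticalCapsCapZeroOne

end Summit.CriticalPhenomena.PercolationContinuityZ3.Theorems

end
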